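import Summits.QuantumFields.YangMills.Theorems.FluctuationComparisonRegPrIntLS2BetaChartJacPinningAE
import Summits.QuantumFields.YangMills.Theorems.FluctuationComparisonRegPrIntLS2BetaChartJacPinningPoint
import HarnessLib

/-!
# S2β · LINE g18-1 · DET-REP-B‴∘ ∕ JACW — (J-PIN) corollary: THE WINDOW CHART'S JACOBIAN IS UNIQUE AT LIVE GOOD POINTS
# (two window charts with the `ChartRows`∕`ChartRowsJ` clauses have equal Jacobians at every charted small-field history)

Cell `ym3-torus` (rung R3: continuum `SU(2)` Yang–Mills on `T³` — NOT `d = 4`, NOT infinite volume, NOT a mass gap, NOT Clay); width seat `ym-ust-20520-w5` g16;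
helper of the crux `stmt-QuantumFields-20520` (`--supports … --as helper`, NOT a proof of it).  FINDING #41 §3 (evidence on 20520).

THE POINT.  `def DetRepB`‴∘ (registry v11.4) quantifies its two value rows over EVERY `c : WindowChart F hJK histGood O` with `ChartRows c ∧ ChartRowsJ c`, while
✓`fourPtDecay_of_detRep` feeds it ONE chart (of record).  THIS FILE certifies that the universal quantification costs the JACW hand NOTHING at the points the row reads:
★★★`windowChart_jac_eq_of_rows` — two window charts `c, ĉ` over the same `(F, hJK, S, O)` (`O` open), each with the off-pivot identity on its live set and a pivot-blind
Jacobian (the `ChartRowsJ` clause), and each carrying at the datum `V₀ ∈ O` and the fine field `U ∈ S` the recognition ∕ relative-openness ∕ carrier-continuity clauses of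
`ChartRows` (`{jac (V₀,·) ≠ 0} ∈ 𝓝 U`, `Φ (V₀,U) = U`, `{Φ (V₀,·) ∈ S}` relatively open in the carrier, `jac (V₀,·)` continuous on it), satisfy `c.jac (V₀, U) = ĉ.jac (V₀, U)`.
Proof: ✓brick 2 `…ChartJacPinningAE.ae_eq_of_two_laws` on the two structure laws `map_Φ` (fibre identity from `descendTo_Φ`, valid `μ_J⌊O ⊗ ν_K`-a.e. since the datum
lies in `O` a.e.; pivot witness `h := fun k => Φ p (β k)`; finite integral from `jac_le`) gives `c.jac =ᵐ ĉ.jac`; ✓brick 3 v1.1 `…ChartJacPinningPoint.windowChart_jac_eq_at_local`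
with `G′ := ĉ.jac`, `N :=` ĉ's live good leaves at `V₀` (a neighbourhood of `U`) and `hGV` from ĉ's OWN `regular` field (first branch on live good leaves) gives the point.
So (road (R1) or (R2) alike): whatever chart the hand computes with — e.g. one whose Jacobian IS ✓p761834's product `1_{windows}·Π_c jd c z (V c)` — its value at a
charted minimiser is THE value `DetRepB`'s bound variable `c` sees.
HONEST SCOPE.  Composition of ✓p762995 and ✓p763077 (v1.1); def-free; default heartbeats; proves nothing of BRD, DETN∕JACW's value bound, DET-REP-B‴∘, S2β or the crux
20520; `YM3TorusSU2` NOT proved; the Yang–Mills mass gap (Clay) NOT proved.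
[cite: Balaban1987RG1, (0.4) p.253 and (2.10) p.267] [cite: Bogachev2007, Thm 2.5.3]
-/

set_option autoImplicit false

noncomputable section

open MeasureTheory Filter Topology Set Function
open scoped ENNReal NNReal
open Literature.MathematicalPhysics.QuantumFieldTheory.Balaban1983to89
open Literature.MathematicalPhysics.QuantumFieldTheory.Balaban1983to89.T3ContinuumYM3Torus
open Literature.MathematicalPhysics.QuantumFieldTheory.Balaban1983to89.T3NestedUnitLaws
open Literature.MathematicalPhysics.QuantumFieldTheory.Balaban1983to89.T3UnitLawDensityEML
open Literature.MathematicalPhysics.QuantumFieldTheory.Balaban1983to89.T3UnitScaleTilt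
open Literature.MathematicalPhysics.QuantumFieldTheory.Balaban1983to89.T3TiltDescent
open Literature.MathematicalPhysics.QuantumFieldTheory.Balaban1983to89.T3LevelShift
open Literature.MathematicalPhysics.QuantumFieldTheory.Balaban1983to89.T4Continuum
open scoped Literature.MathematicalPhysics.QuantumFieldTheory.Balaban1983to89.T3OrbitAverage

namespace Summit.QuantumFields.YangMills.Theorems.FluctuationComparisonRegPrIntLS2BetaChartJacUniqueAtGoodPoints

open Summit.QuantumFields.YangMills.Theorems.FluctuationComparisonRegPrIntLS2BetaChartJacPinningAE (ae_eq_of_two_laws)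
open Summit.QuantumFields.YangMills.Theorems.FluctuationComparisonRegPrIntLS2BetaChartJacPinningPoint (windowChart_jac_eq_at_local)

variable (F : T3Family) {J K : ℕ} (hJK : J ≤ K)

/-- **The fibre-identity and pivot rows of a window chart's own law, `μ_J⌊O ⊗ ν_K`-a.e.** (from the structure field `descendTo_Φ` — the datum lies in `O` a.e. — and
the off-pivot identity on the live set; the pivot witness is `h := fun k => c.Φ p (β k)`, no injectivity of `β` needed), and the finiteness of `∫ c.jac` (`jac_le`).
[cite: Balaban1987RG1, (2.10) p.267] -/
theorem windowChart_law_rows {S : Set (GaugeField (F.P K) 0 (Matrix.specialUnitaryGroup (Fin 2) ℂ))}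
    {O : Set (GaugeField (F.P J) 0 (Matrix.specialUnitaryGroup (Fin 2) ℂ))} (hO : MeasurableSet O)
    (c : Summit.QuantumFields.YangMills.Theorems.FluctuationComparisonRegPrIntLWregGlue.WindowChart F hJK S O)
    {κ : Type*} (β : κ → PBond (F.P K) 0)
    (hoff : ∀ V z, c.jac (V, z) ≠ 0 → ∀ b, (∀ k, β k ≠ b) → c.Φ (V, z) b = z b) :
    (∀ᵐ p ∂((fieldMeasure (F.P J) 0 (Matrix.specialUnitaryGroup (Fin 2) ℂ)).restrict O).prod (fieldMeasure (F.P K) 0 (Matrix.specialUnitaryGroup (Fin 2) ℂ)),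
        (c.jac p : ℝ≥0∞) ≠ 0 → descendTo F ℰp J K hJK (c.Φ p) = p.1) ∧
      (∀ᵐ p ∂((fieldMeasure (F.P J) 0 (Matrix.specialUnitaryGroup (Fin 2) ℂ)).restrict O).prod (fieldMeasure (F.P K) 0 (Matrix.specialUnitaryGroup (Fin 2) ℂ)),
        (c.jac p : ℝ≥0∞) ≠ 0 → ∃ h : κ → Matrix.specialUnitaryGroup (Fin 2) ℂ, c.Φ p = extend β h p.2) ∧
      ∫⁻ p, (c.jac p : ℝ≥0∞) ∂((fieldMeasure (F.P J) 0 (Matrix.specialUnitaryGroup (Fin 2) ℂ)).restrict O).prod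
        (fieldMeasure (F.P K) 0 (Matrix.specialUnitaryGroup (Fin 2) ℂ)) ≠ ∞ := by
  set M := ((fieldMeasure (F.P J) 0 (Matrix.specialUnitaryGroup (Fin 2) ℂ)).restrict O).prod
        (fieldMeasure (F.P K) 0 (Matrix.specialUnitaryGroup (Fin 2) ℂ)) with hM
  have hO' : ∀ᵐ p ∂M, p.1 ∈ O := by
    have hset : MeasurableSet {p : GaugeField (F.P J) 0 (Matrix.specialUnitaryGroup (Fin 2) ℂ) ×
        GaugeField (F.P K) 0 (Matrix.specialUnitaryGroup (Fin 2) ℂ) | p.1 ∈ O} := measurable_fst hO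
    refine (Measure.ae_prod_iff_ae_ae hset).2 ?_
    filter_upwards [ae_restrict_mem hO] with V hV
    exact Filter.Eventually.of_forall fun _ => hV
  refine ⟨?_, Filter.Eventually.of_forall fun p hj => ⟨fun k => c.Φ p (β k), ?_⟩, ?_⟩
  · filter_upwards [hO'] with p hp hj
    exact c.descendTo_Φ p.1 hp p.2 (by exact_mod_cast hj)
  · have hj' : c.jac (p.1, p.2) ≠ 0 := by exact_mod_cast hj
    funext b
    by_cases hb : ∃ k, β k = b
    · classical
      rw [Function.extend_def, dif_pos hb]
      exact congrArg (c.Φ p) (Classical.choose_spec hb).symm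
    · rw [extend_apply' _ _ _ hb]
      exact hoff p.1 p.2 hj' b fun k hk => hb ⟨k, hk⟩
  · refine ne_top_of_le_ne_top ?_ (lintegral_mono fun p => ENNReal.coe_le_coe.2 (c.jac_le p))
    rw [lintegral_const]
    exact ENNReal.mul_ne_top ENNReal.coe_ne_top (measure_ne_top M _)

/-- The continuity of `(c.jac (·, z) : ℝ≥0∞)` from that of `(c.jac (·, z) : ℝ)` (the `regular` field's letter). [folklore] -/
theorem continuousAt_coe_ennreal_of_coe_real {X : Type*} [TopologicalSpace X] {f : X → ℝ≥0} {x : X}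
    (h : ContinuousAt (fun y => (f y : ℝ)) x) : ContinuousAt (fun y => (f y : ℝ≥0∞)) x :=
  ENNReal.continuous_coe.continuousAt.comp (continuous_real_toNNReal.continuousAt.comp h |>.congr (Eventually.of_forall fun y => by
    simp only [Function.comp, Real.toNNReal_coe]))

/-- ★★★ **THE WINDOW CHART'S JACOBIAN IS UNIQUE AT LIVE GOOD POINTS.**  Two window charts `c, ĉ : WindowChart F hJK S O` (`O` open and measurable), each with a
pivot-blind Jacobian and the off-pivot identity on its live set (pivots `β`, in the tower `iterCentralBond (K − J)`), and each carrying at `(V₀, U)` (`V₀ ∈ O`, `U ∈ S`) the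
four `ChartRows` clauses — live carrier a neighbourhood of `U`, `Φ (V₀, U) = U`, `{Φ (V₀,·) ∈ S}` relatively open in the carrier, `jac (V₀,·)` continuous on it — have
`c.jac (V₀, U) = ĉ.jac (V₀, U)`.  Consequently the ∀-chart quantification of `def DetRepB`‴∘'s JACW-ROW is harmless at the points it reads. [cite: Balaban1987RG1, (2.10) p.267]
[cite: Bogachev2007, Thm 2.5.3] -/
theorem windowChart_jac_eq_of_rows {S : Set (GaugeField (F.P K) 0 (Matrix.specialUnitaryGroup (Fin 2) ℂ))}
    {O : Set (GaugeField (F.P J) 0 (Matrix.specialUnitaryGroup (Fin 2) ℂ))} (hO : MeasurableSet O) (hOo : IsOpen O)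
    (c ĉ : Summit.QuantumFields.YangMills.Theorems.FluctuationComparisonRegPrIntLWregGlue.WindowChart F hJK S O)
    {κ : Type*} (β : κ → PBond (F.P K) 0)
    (hoff : ∀ V z, c.jac (V, z) ≠ 0 → ∀ b, (∀ k, β k ≠ b) → c.Φ (V, z) b = z b)
    (hjbl : ∀ V z (h : κ → Matrix.specialUnitaryGroup (Fin 2) ℂ), c.jac (V, extend β h z) = c.jac (V, z))
    (hoff' : ∀ V z, ĉ.jac (V, z) ≠ 0 → ∀ b, (∀ k, β k ≠ b) → ĉ.Φ (V, z) b = z b)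
    (hjbl' : ∀ V z (h : κ → Matrix.specialUnitaryGroup (Fin 2) ℂ), ĉ.jac (V, extend β h z) = ĉ.jac (V, z))
    {V₀ : GaugeField (F.P J) 0 (Matrix.specialUnitaryGroup (Fin 2) ℂ)} (hV₀ : V₀ ∈ O)
    {U : GaugeField (F.P K) 0 (Matrix.specialUnitaryGroup (Fin 2) ℂ)} (hUS : U ∈ S)
    (hcarr : {z | c.jac (V₀, z) ≠ 0} ∈ 𝓝 U) (hΦU : c.Φ (V₀, U) = U)
    (hrel : IsOpen ((Subtype.val : {z | c.jac (V₀, z) ≠ 0} → GaugeField (F.P K) 0 (Matrix.specialUnitaryGroup (Fin 2) ℂ)) ⁻¹' {z | c.Φ (V₀, z) ∈ S}))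
    (hcz : ContinuousOn (fun z => (c.jac (V₀, z) : ℝ)) {z | c.jac (V₀, z) ≠ 0})
    (hcarr' : {z | ĉ.jac (V₀, z) ≠ 0} ∈ 𝓝 U) (hΦU' : ĉ.Φ (V₀, U) = U)
    (hrel' : IsOpen ((Subtype.val : {z | ĉ.jac (V₀, z) ≠ 0} → GaugeField (F.P K) 0 (Matrix.specialUnitaryGroup (Fin 2) ℂ)) ⁻¹' {z | ĉ.Φ (V₀, z) ∈ S}))
    (hcz' : ContinuousOn (fun z => (ĉ.jac (V₀, z) : ℝ)) {z | ĉ.jac (V₀, z) ≠ 0}) :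
    c.jac (V₀, U) = ĉ.jac (V₀, U) := by
  have hDm : Measurable (descendTo F ℰp J K hJK) := measurable_descendTo F ℰp measurableE_ℰp hJK
  obtain ⟨hfib, hpiv, hfin⟩ := windowChart_law_rows F hJK hO c β hoff
  obtain ⟨hfib', hpiv', -⟩ := windowChart_law_rows F hJK hO ĉ β hoff'
  -- (a.e.) the two structure laws `map_Φ` are two pivot-moving laws of the same restricted Haar measure
  have hae : (fun p => (c.jac p : ℝ≥0∞)) =ᵐ[((fieldMeasure (F.P J) 0 (Matrix.specialUnitaryGroup (Fin 2) ℂ)).restrict O).prod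
      (fieldMeasure (F.P K) 0 (Matrix.specialUnitaryGroup (Fin 2) ℂ))] (fun p => (ĉ.jac p : ℝ≥0∞)) :=
    ae_eq_of_two_laws hDm β c.measurable_Φ ĉ.measurable_Φ c.measurable_jac.coe_nnreal_ennreal ĉ.measurable_jac.coe_nnreal_ennreal
      c.map_Φ ĉ.map_Φ hfib hpiv hfib' hpiv' (fun h p => by exact_mod_cast hjbl p.1 p.2 h) (fun h p => by exact_mod_cast hjbl' p.1 p.2 h) hfin
  -- (point) ĉ's live good leaves at `V₀` are a neighbourhood of `U` on which, a.e., ĉ's `regular` field is in its first branch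
  obtain ⟨Gop, hGop, hGeq⟩ := hrel'
  have hUG : U ∈ Gop := by
    have hUcarr : U ∈ {z | ĉ.jac (V₀, z) ≠ 0} := mem_of_mem_nhds hcarr'
    have h1 : (⟨U, hUcarr⟩ : {z | ĉ.jac (V₀, z) ≠ 0}) ∈ (Subtype.val ⁻¹' {z | ĉ.Φ (V₀, z) ∈ S}) := by
      show ĉ.Φ (V₀, U) ∈ S
      rw [hΦU']; exact hUS
    rw [← hGeq] at h1
    exact h1
  have hN : {z | ĉ.jac (V₀, z) ≠ 0 ∧ ĉ.Φ (V₀, z) ∈ S} ∈ 𝓝 U := by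
    filter_upwards [hcarr', hGop.mem_nhds hUG] with z hz hzG
    have h1 : (⟨z, hz⟩ : {z | ĉ.jac (V₀, z) ≠ 0}) ∈ Subtype.val ⁻¹' Gop := hzG
    rw [hGeq] at h1
    exact ⟨hz, h1⟩
  have hGV : ∀ᵐ z ∂fieldMeasure (F.P K) 0 (Matrix.specialUnitaryGroup (Fin 2) ℂ),
      z ∈ {z | ĉ.jac (V₀, z) ≠ 0 ∧ ĉ.Φ (V₀, z) ∈ S} → ContinuousAt (fun V => (ĉ.jac (V, z) : ℝ≥0∞)) V₀ := by
    filter_upwards [ĉ.regular V₀ hV₀] with z hz hzN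
    rcases hz with ⟨hcont, -, -⟩ | hdead
    · exact continuousAt_coe_ennreal_of_coe_real hcont
    · exfalso
      rcases hdead.self_of_nhds with h0 | hS
      · exact hzN.1 h0
      · exact hS hzN.2
  have hGz : ContinuousAt (fun z => (ĉ.jac (V₀, z) : ℝ≥0∞)) U := continuousAt_coe_ennreal_of_coe_real (hcz'.continuousAt hcarr')
  have h := windowChart_jac_eq_at_local F hJK hOo c ĉ.measurable_jac.coe_nnreal_ennreal hae hV₀ hUS hcarr hΦU hrel hcz hN hGV hGz
  exact_mod_cast h

end Summit.QuantumFields.YangMills.Theorems.FluctuationComparisonRegPrIntLS2BetaChartJacUniqueAtGoodPoints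

end
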